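import Literature.LinearAlgebra.Matrix.LoewnerFormKernelRealRoots

/-!
# Even-simple matrices (Connes–Consani–Moscovici 2025, Def. 5.3) and the real-zeros theorems in that language

Source, read verbatim (held text `paper:arxiv-2511.22755`, p. 16 = store page p0018): A. Connes,
C. Consani, H. Moscovici, *Zeta spectral triples*, arXiv:2511.22755 (2025) [bib: `ConnesConsaniMoscovici2025`]:

> **Definition 5.3.** A real symmetric matrix `T` commuting with the `ℤ/2`-grading `γ` is
> *even-simple* if its smallest eigenvalue is simple and the corresponding eigenvector `ξ` satisfies
> `γξ = ξ`.

It is the hypothesis of CCM Prop. 5.7 / Thm. 5.10 ("Let `ε_N` be the smallest eigenvalue of `QW^N_λ`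
assumed simple and `ξ` the corresponding eigenvector assumed even") and of Connes' Letter
(arXiv:2602.04022) Thm. 6.1, and §8 of CCM names proving it for `QW_λ` as "the first missing step".
This file only NAMES the notion (with explicit witnesses `ε`, `ξ`, which is how it is certified at a
given truncation level) and restates, in this language, the finite-dimensional real-zeros theorems of
Connes–van Suijlekom (`Literature/LinearAlgebra/Matrix/LoewnerFormKernelRealRoots.lean`): for an
even-simple `T` whose off-diagonal part is a divided-difference matrix `(b_i - b_j)/(λ_i - λ_j)`
(C–vS Prop. 4.1 / (5.9); CCM Lemma 5.4's setting), the kernel interpolant of `T - ε` has only real roots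
and the Fourier transform of `Σ ξ_k e^{2πikx/L}` on `[0, L]` has only real zeros.

## Encoding

"smallest eigenvalue `ε`, simple, with even eigenvector `ξ`" is written without spectral theory as:
`T - ε·1` is positive semidefinite (so `ε ≤` every eigenvalue), `(T - ε·1) ξ = 0` with `ξ ≠ 0` (so `ε`
IS an eigenvalue, the smallest), every kernel vector of `T - ε·1` is a multiple of `ξ` (simplicity), and
`ξ ∘ σ = ξ` (evenness; `γ e_j = e_{σ j}`). "Commuting with `γ`" is `T (σ i) (σ j) = T i j`.

Deliberately NOT here: any claim that a particular matrix (e.g. a truncated Weil form) is even-simple.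
-/

noncomputable section

open Finset Matrix Complex MeasureTheory

open scoped Real

namespace Literature.LinearAlgebra.Matrix

namespace ConnesConsaniMoscovici

variable {ι : Type*} [Fintype ι] [DecidableEq ι]

/-- **CCM Def. 5.3 with explicit witnesses.** `IsEvenSimpleWith σ T ε ξ`: the real matrix `T` commutes
with the grading `γ e_j = e_{σ j}`, `ε` is its smallest eigenvalue (`T - ε` positive semidefinite with
`(T - ε) ξ = 0`, `ξ ≠ 0`), this eigenvalue is simple (the kernel of `T - ε` is the line `ℝ ξ`), and the
eigenvector is even (`ξ_{σ j} = ξ_j`). [cite: ConnesConsaniMoscovici2025, Definition 5.3] -/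
def IsEvenSimpleWith (σ : ι → ι) (T : Matrix ι ι ℝ) (ε : ℝ) (ξ : ι → ℝ) : Prop :=
  (∀ i j, T (σ i) (σ j) = T i j) ∧ ξ ≠ 0 ∧ (∀ i, ξ (σ i) = ξ i) ∧
    (T - ε • (1 : Matrix ι ι ℝ)).PosSemidef ∧ (T - ε • (1 : Matrix ι ι ℝ)) *ᵥ ξ = 0 ∧
    ∀ v : ι → ℝ, (T - ε • (1 : Matrix ι ι ℝ)) *ᵥ v = 0 → ∃ c : ℝ, v = c • ξ

/-- **CCM Def. 5.3.** A real symmetric matrix commuting with the grading `γ e_j = e_{σ j}` is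
*even-simple* if its smallest eigenvalue is simple with an even eigenvector.
[cite: ConnesConsaniMoscovici2025, Definition 5.3] -/
def IsEvenSimple (σ : ι → ι) (T : Matrix ι ι ℝ) : Prop :=
  ∃ ε : ℝ, ∃ ξ : ι → ℝ, IsEvenSimpleWith σ T ε ξ

namespace IsEvenSimpleWith

variable {σ : ι → ι} {T : Matrix ι ι ℝ} {ε : ℝ} {ξ : ι → ℝ}

/-- Witnesses give the property. [cite: ConnesConsaniMoscovici2025, Definition 5.3] -/
theorem isEvenSimple (h : IsEvenSimpleWith σ T ε ξ) : IsEvenSimple σ T := ⟨ε, ξ, h⟩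

/-- `T` commutes with the grading. [cite: ConnesConsaniMoscovici2025, Definition 5.3] -/
theorem comm (h : IsEvenSimpleWith σ T ε ξ) (i j : ι) : T (σ i) (σ j) = T i j := h.1 i j

/-- The eigenvector is non-zero. [cite: ConnesConsaniMoscovici2025, Definition 5.3] -/
theorem ne_zero (h : IsEvenSimpleWith σ T ε ξ) : ξ ≠ 0 := h.2.1

/-- The eigenvector is even. [cite: ConnesConsaniMoscovici2025, Definition 5.3] -/
theorem even (h : IsEvenSimpleWith σ T ε ξ) (i : ι) : ξ (σ i) = ξ i := h.2.2.1 i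

/-- `T - ε` is positive semidefinite. [cite: ConnesConsaniMoscovici2025, Definition 5.3] -/
theorem posSemidef (h : IsEvenSimpleWith σ T ε ξ) : (T - ε • (1 : Matrix ι ι ℝ)).PosSemidef :=
  h.2.2.2.1

/-- `(T - ε) ξ = 0`. [cite: ConnesConsaniMoscovici2025, Definition 5.3] -/
theorem mulVec_eq_zero (h : IsEvenSimpleWith σ T ε ξ) : (T - ε • (1 : Matrix ι ι ℝ)) *ᵥ ξ = 0 :=
  h.2.2.2.2.1

/-- The kernel of `T - ε` is the line through `ξ`. [cite: ConnesConsaniMoscovici2025, Definition 5.3] -/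
theorem ker (h : IsEvenSimpleWith σ T ε ξ) (v : ι → ℝ) (hv : (T - ε • (1 : Matrix ι ι ℝ)) *ᵥ v = 0) :
    ∃ c : ℝ, v = c • ξ :=
  h.2.2.2.2.2 v hv

/-- `ξ` is an eigenvector of `T` for `ε`: `T ξ = ε ξ`. [cite: ConnesConsaniMoscovici2025, Definition 5.3] -/
theorem eigen (h : IsEvenSimpleWith σ T ε ξ) : T *ᵥ ξ = ε • ξ := by
  have h1 := h.mulVec_eq_zero
  rw [sub_mulVec, smul_mulVec, one_mulVec, sub_eq_zero] at h1
  exact h1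

/-- `ε` is the bottom of the spectrum: `ε ‖v‖² ≤ ⟨v, T v⟩` for every `v`.
[cite: ConnesConsaniMoscovici2025, Definition 5.3] -/
theorem le_rayleigh (h : IsEvenSimpleWith σ T ε ξ) (v : ι → ℝ) :
    ε * (v ⬝ᵥ v) ≤ v ⬝ᵥ (T *ᵥ v) := by
  have h1 : 0 ≤ v ⬝ᵥ ((T - ε • (1 : Matrix ι ι ℝ)) *ᵥ v) := by
    simpa using h.posSemidef.dotProduct_mulVec_nonneg v
  rw [sub_mulVec, smul_mulVec, one_mulVec, dotProduct_sub, dotProduct_smul, smul_eq_mul] at h1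
  linarith

omit [Fintype ι] in
/-- The off-diagonal entries of `T - ε` are those of `T`. [folklore] -/
private theorem sub_smul_one_apply_of_ne (T : Matrix ι ι ℝ) (ε : ℝ) {i j : ι} (hij : i ≠ j) :
    (T - ε • (1 : Matrix ι ι ℝ)) i j = T i j := by
  rw [Matrix.sub_apply, Matrix.smul_apply, Matrix.one_apply_ne hij, smul_zero, sub_zero]

/-- **C–vS Prop. 5.10 for an even-simple matrix** (CCM Lemma 5.4's setting: `T` even-simple, and
— C–vS (5.9) — `T_{ij} = (b_i - b_j)/(λ_i - λ_j)` for `i ≠ j` with `λ` simple and odd, `b` odd under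
`σ`, `σ` an involution): every complex root of `P(s) = Σ_k ξ_k Π_{j ≠ k} (λ_j - s)`, `ξ` the even
bottom eigenvector, is real. [cite: ConnesSuijlekom2025, Proposition 5.10] -/
theorem im_eq_zero_of_dividedDifference (h : IsEvenSimpleWith σ T ε ξ) (hσ : Function.Involutive σ)
    {lam b : ι → ℝ} (hlam : Function.Injective lam) (hlamσ : ∀ i, lam (σ i) = -lam i)
    (hbσ : ∀ i, b (σ i) = -b i) (hToff : ∀ i j, i ≠ j → T i j = (b i - b j) / (lam i - lam j))
    {μ : ℂ} (hP : ∑ k, (ξ k : ℂ) * ∏ j ∈ univ.erase k, ((lam j : ℂ) - μ) = 0) :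
    μ.im = 0 :=
  ConnesVanSuijlekom.im_eq_zero_of_even_kernel hσ hlam hlamσ hbσ
    (Q := T - ε • (1 : Matrix ι ι ℝ))
    (fun i j hij => by rw [sub_smul_one_apply_of_ne T ε hij, hToff i j hij])
    h.posSemidef h.ne_zero h.mulVec_eq_zero h.ker h.even hP

end IsEvenSimpleWith

/-! ## Index sets of integers: `γ e_k = e_{-k}` -/

/-- The grading `k ↦ -k` on a finite set of integers `S = -S`. [cite: ConnesSuijlekom2025, Lemma 5.1 (i)] -/
def reflect (S : Finset ℤ) (hS : ∀ j ∈ S, -j ∈ S) : S → S := fun j => ⟨-(j : ℤ), hS j j.2⟩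

/-- `reflect` is the negation on values. [cite: ConnesSuijlekom2025, Lemma 5.1 (i)] -/
@[simp] theorem coe_reflect (S : Finset ℤ) (hS : ∀ j ∈ S, -j ∈ S) (j : S) :
    ((reflect S hS j : S) : ℤ) = -(j : ℤ) := rfl

/-- `reflect` is an involution (`γ² = 1`). [cite: ConnesSuijlekom2025, Lemma 5.1 (i)] -/
theorem reflect_involutive (S : Finset ℤ) (hS : ∀ j ∈ S, -j ∈ S) :
    Function.Involutive (reflect S hS) :=
  fun j => Subtype.ext (by simp)

/-- **C–vS Thm. 5.6 (i) for an even-simple matrix on `S = -S ⊂ ℤ`** (`λ_k = k`): if `T` is even-simple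
for `k ↦ -k` with bottom eigenvector `ξ`, and `T_{ij} = (b_i - b_j)/(i - j)` off the diagonal with
`b_{-i} = -b_i`, then all roots of `Σ_k ξ_k Π_{j ≠ k}(j - s)` are real.
[cite: ConnesSuijlekom2025, Theorem 5.6 (i)] -/
theorem IsEvenSimpleWith.im_eq_zero_int (S : Finset ℤ) (hS : ∀ j ∈ S, -j ∈ S)
    {T : Matrix S S ℝ} {ε : ℝ} {ξ : S → ℝ} (h : IsEvenSimpleWith (reflect S hS) T ε ξ)
    {b : S → ℝ} (hb : ∀ i : S, b (reflect S hS i) = -b i)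
    (hToff : ∀ i j : S, i ≠ j → T i j = (b i - b j) / (((i : ℤ) : ℝ) - ((j : ℤ) : ℝ)))
    {μ : ℂ} (hP : ∑ k : S, (ξ k : ℂ) * ∏ j ∈ univ.erase k, (((j : ℤ) : ℂ) - μ) = 0) :
    μ.im = 0 := by
  have hb' : ∀ i j : S, (i : ℤ) = -(j : ℤ) → b i = -b j := by
    intro i j hij
    have hi : i = reflect S hS j := Subtype.ext (by simpa using hij)
    rw [hi, hb]
  have hξ' : ∀ i j : S, (i : ℤ) = -(j : ℤ) → ξ i = ξ j := by
    intro i j hij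
    have hi : i = reflect S hS j := Subtype.ext (by simpa using hij)
    rw [hi, h.even]
  exact ConnesVanSuijlekom.im_eq_zero_of_even_kernel_int S hS (Q := T - ε • (1 : Matrix S S ℝ)) hb'
    (fun i j hij => by rw [Matrix.sub_apply, Matrix.smul_apply, Matrix.one_apply_ne hij, smul_zero, sub_zero, hToff i j hij])
    h.posSemidef h.ne_zero h.mulVec_eq_zero h.ker hξ' hP

/-- **C–vS Thm. 5.6 (ii) / CCM Thm. 5.10 (iii) at finite `N`, for an even-simple matrix on
`S = -S ⊂ ℤ`:** with `T`, `ξ`, `b` as in `IsEvenSimpleWith.im_eq_zero_int` and `L > 0`, every zero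
`z ∈ ℂ` of `∫_0^L (Σ_{k ∈ S} ξ_k e^{2πikx/L}) e^{-izx} dx` is real.
[cite: ConnesSuijlekom2025, Theorem 5.6 (ii)] -/
theorem IsEvenSimpleWith.fourierIntegral_eq_zero_im_eq_zero (S : Finset ℤ) (hS : ∀ j ∈ S, -j ∈ S)
    {T : Matrix S S ℝ} {ε : ℝ} {ξ : S → ℝ} (h : IsEvenSimpleWith (reflect S hS) T ε ξ)
    {b : S → ℝ} (hb : ∀ i : S, b (reflect S hS i) = -b i)
    (hToff : ∀ i j : S, i ≠ j → T i j = (b i - b j) / (((i : ℤ) : ℝ) - ((j : ℤ) : ℝ)))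
    {L : ℝ} (hL : 0 < L) {z : ℂ}
    (hz : ∫ x in (0 : ℝ)..L, (∑ k : S, (ξ k : ℂ) * cexp (2 * π * I * ((k : ℤ) : ℂ) * (x : ℂ) / (L : ℂ)))
      * cexp (-(I * z * (x : ℂ))) = 0) :
    z.im = 0 := by
  have hb' : ∀ i j : S, (i : ℤ) = -(j : ℤ) → b i = -b j := by
    intro i j hij
    have hi : i = reflect S hS j := Subtype.ext (by simpa using hij)
    rw [hi, hb]
  have hξ' : ∀ i j : S, (i : ℤ) = -(j : ℤ) → ξ i = ξ j := by
    intro i j hij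
    have hi : i = reflect S hS j := Subtype.ext (by simpa using hij)
    rw [hi, h.even]
  exact ConnesVanSuijlekom.fourierIntegral_eq_zero_im_eq_zero_of_length S hS
    (Q := T - ε • (1 : Matrix S S ℝ)) hb'
    (fun i j hij => by rw [Matrix.sub_apply, Matrix.smul_apply, Matrix.one_apply_ne hij, smul_zero, sub_zero, hToff i j hij])
    h.posSemidef h.ne_zero h.mulVec_eq_zero h.ker hξ' hL hz

end ConnesConsaniMoscovici

end Literature.LinearAlgebra.Matrix
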